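import Mathlib
import Summits.ABC.ABC.Statement
import Summits.ABC.ABC.Theorems.SoloInformedPhilipponDoor

/-!
# Philippon's conjecture is a RUNG: abc ⟹ PL (solo-ABC-informed, session 17)

`SoloInformedPhilipponDoor.lean` (session 10, landed) proves that Philippon's 2000 conjecture

> **PL.** There are reals `0 ≤ ε < 1/2`, `α, β ≥ 0` and an integer `B ≥ 1` such that for all
> `x, y ∈ ℚ^×` with `x y^B ≠ −1`,
> `log |num (x y^B + 1)| ≤ B · (α h(x) + ε h(y)) + (α B + ε) · (log rad num (x y^B + 1) + β)`

implies polynomial abc (W), and that PL with `ε = 1` is Liouville's inequality.  This file adds the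
converse edge of the ladder: **the abc conjecture implies PL** (with `B = 5`, `ε = α = 9/20`), so that
PL is sandwiched, `ABC ⟹ PL ⟹ (W)`, and is therefore a NECESSARY waypoint of any proof of abc and not
merely a sufficient "door".  The argument is Philippon's *Remarque (3)* [cite: Philippon2000Addendum,
Remarque (3), p. 168] made explicit: for `X = x y^B = m/n` in lowest terms, `num (X + 1) = m + n`, the three
coprime integers `|m|, n, |m + n|` form an abc-triple whose largest member is at least `|m + n|`, and
`rad(m) · rad(n) ≤ |num x| |num y| · den x · den y ≤ H(x)² H(y)²`; abc at exponent `1 + η` gives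

  `log |num (x y^B + 1)| < log K_η + (1 + η) · (2 h(x) + 2 h(y) + log rad num (x y^B + 1))`

for EVERY `B` (`soloInformed_philipponShape_of_abc`) — a coefficient on `h(y)` independent of `B`, where
Liouville has `B` and PL asks `ε B` with `ε < 1/2` — and `B = 5`, `η = 1/8` puts it in PL's shape
(`soloInformed_philippon_of_abc`; for every `B ≥ 5` one may take `ε = α = 9/(4B)`,
`soloInformed_philippon_of_abc_of_le`).  `soloInformed_PL_rung` records the sandwich
`(ABC → PL) ∧ (PL → (W))` in one declaration, the second conjunct being
`soloInformed_polynomialABC_of_philippon` of the session-10 file.  Mathlib + `Statement` +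
`SoloInformedPhilipponDoor` only; no new `Prop` constants.

Role in the seat's report (`run/shared/lean/ideation/ABC/solo-informed/paper/paper.md` §2.0): of the four
linear-forms doors of the ladder, two are now kernel-certified consequences of the summit — Baker's
`Ξ`-estimate (equivalent, `SoloInformedBakerXi.lean`) and PL (this file) — while the one-place door `H(σ)`
and Baker's weak `Ξ`-form are not implied by abc on their face (they bound the depth at ONE prime).
[cite: Philippon2000Addendum, Conjecture and Remarque (3), p. 167–168]
-/

noncomputable section

open Real Height UniqueFactorizationMonoid
open Literature.NumberTheory.DiophantineGeometry

namespace Summit.ABC.ABC.Theorems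

/-! ### Bookkeeping on numerators and denominators -/

/-- `num (X + 1) = num X + den X` for `X ∈ ℚ`. [folklore] -/
theorem soloInformed_num_add_one (X : ℚ) : (X + 1).num = X.num + X.den := by
  have hden : (X + 1).den = X.den := by
    have h := Rat.add_natCast_den X 1
    simp only [Nat.cast_one] at h
    exact h
  have h1 : (X + 1) * ((X + 1).den : ℚ) = ((X + 1).num : ℚ) := Rat.mul_den_eq_num (X + 1)
  rw [hden, add_mul, Rat.mul_den_eq_num, one_mul] at h1
  exact_mod_cast h1.symm

/-- The reduced numerator of `x · y^B` divides `num x · (num y)^B` and its denominator divides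
`den x · (den y)^B`. [folklore] -/
theorem soloInformed_num_den_mul_pow_dvd (x y : ℚ) (B : ℕ) :
    (x * y ^ B).num ∣ x.num * y.num ^ B ∧ ((x * y ^ B).den : ℤ) ∣ (x.den : ℤ) * (y.den : ℤ) ^ B := by
  have hX : x * y ^ B = Rat.divInt (x.num * y.num ^ B) ((x.den : ℤ) * (y.den : ℤ) ^ B) := by
    conv_lhs => rw [← Rat.num_divInt_den x, Rat.pow_eq_divInt y B]
    rw [Rat.divInt_mul_divInt]
  have hd : ((x.den : ℤ) * (y.den : ℤ) ^ B) ≠ 0 := by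
    have h1 : (x.den : ℤ) ≠ 0 := by exact_mod_cast x.den_nz
    have h2 : (y.den : ℤ) ≠ 0 := by exact_mod_cast y.den_nz
    exact mul_ne_zero h1 (pow_ne_zero _ h2)
  refine ⟨?_, ?_⟩
  · rw [hX]; exact Rat.num_dvd _ hd
  · rw [hX]; exact Rat.den_dvd _ _

/-- `rad` of the reduced numerator of `x · y^B` is at most `|num x| · |num y|`, and `rad` of its
denominator is at most `den x · den y`. [folklore] -/
theorem soloInformed_radical_num_den_mul_pow_le {x y : ℚ} (hx : x ≠ 0) (hy : y ≠ 0) (B : ℕ) :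
    radical (x * y ^ B).num.natAbs ≤ x.num.natAbs * y.num.natAbs ∧
      radical (x * y ^ B).den ≤ x.den * y.den := by
  obtain ⟨hnum, hden⟩ := soloInformed_num_den_mul_pow_dvd x y B
  have hxn : x.num.natAbs ≠ 0 := Int.natAbs_ne_zero.mpr (Rat.num_ne_zero.mpr hx)
  have hyn : y.num.natAbs ≠ 0 := Int.natAbs_ne_zero.mpr (Rat.num_ne_zero.mpr hy)
  have hxd : x.den ≠ 0 := x.den_nz
  have hyd : y.den ≠ 0 := y.den_nz
  constructor
  · have h1 : (x * y ^ B).num.natAbs ∣ x.num.natAbs * y.num.natAbs ^ B := by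
      have := Int.natAbs_dvd_natAbs.mpr hnum
      simpa [Int.natAbs_mul, Int.natAbs_pow] using this
    have h2 : radical (x * y ^ B).num.natAbs ∣ radical x.num.natAbs * radical y.num.natAbs :=
      calc radical (x * y ^ B).num.natAbs ∣ radical (x.num.natAbs * y.num.natAbs ^ B) :=
            radical_dvd_radical h1 (mul_ne_zero hxn (pow_ne_zero _ hyn))
        _ ∣ radical x.num.natAbs * radical (y.num.natAbs ^ B) := radical_mul_dvd
        _ ∣ radical x.num.natAbs * radical y.num.natAbs :=
            mul_dvd_mul_left _ radical_pow_dvd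
    have h3 : radical x.num.natAbs * radical y.num.natAbs ∣ x.num.natAbs * y.num.natAbs :=
      mul_dvd_mul radical_dvd_self radical_dvd_self
    exact Nat.le_of_dvd (Nat.pos_of_ne_zero (mul_ne_zero hxn hyn)) (h2.trans h3)
  · have h1 : (x * y ^ B).den ∣ x.den * y.den ^ B := by exact_mod_cast hden
    have h2 : radical (x * y ^ B).den ∣ radical x.den * radical y.den :=
      calc radical (x * y ^ B).den ∣ radical (x.den * y.den ^ B) :=
            radical_dvd_radical h1 (mul_ne_zero hxd (pow_ne_zero _ hyd))
        _ ∣ radical x.den * radical (y.den ^ B) := radical_mul_dvd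
        _ ∣ radical x.den * radical y.den := mul_dvd_mul_left _ radical_pow_dvd
    have h3 : radical x.den * radical y.den ∣ x.den * y.den :=
      mul_dvd_mul radical_dvd_self radical_dvd_self
    exact Nat.le_of_dvd (Nat.pos_of_ne_zero (mul_ne_zero hxd hyd)) (h2.trans h3)

/-- `log |num q| ≤ h(q)` and `log den q ≤ h(q)` for `q ∈ ℚ^×`. [folklore] -/
theorem soloInformed_log_num_den_le_logHeight₁ {q : ℚ} (hq : q ≠ 0) :
    Real.log (q.num.natAbs : ℝ) ≤ logHeight₁ q ∧ Real.log (q.den : ℝ) ≤ logHeight₁ q := by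
  rw [Rat.logHeight₁_eq_log_max]
  have hn : 0 < q.num.natAbs := Int.natAbs_pos.mpr (Rat.num_ne_zero.mpr hq)
  have hd : 0 < q.den := q.pos
  have hn' : (0 : ℝ) < q.num.natAbs := by exact_mod_cast hn
  have hd' : (0 : ℝ) < q.den := by exact_mod_cast hd
  constructor
  · refine Real.log_le_log hn' ?_
    exact_mod_cast le_max_left _ _
  · refine Real.log_le_log hd' ?_
    exact_mod_cast le_max_right _ _

/-! ### The abc-triple hidden in `num (X + 1)` -/

/-- **The triple.** If every abc-triple satisfies `c < K · rad(abc)^{1+η}`, then for every `X ∈ ℚ`,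
`X ≠ 0, −1`, writing `X = m/n` in lowest terms (so `num (X+1) = m + n`),
`|m + n| < K · rad(|m| · n · |m + n|)^{1+η}`: the coprime integers `|m|, n, |m+n|` are an abc-triple in
some order, with largest member `≥ |m + n|`. [cite: Philippon2000Addendum, Remarque (3), p. 168] -/
theorem soloInformed_abcShape_num_add_one {η K : ℝ}
    (hK : ∀ a b c : ℕ, IsABCTriple a b c → (c : ℝ) < K * ((rad a b c : ℕ) : ℝ) ^ (1 + η))
    {X : ℚ} (hX0 : X ≠ 0) (hX1 : X + 1 ≠ 0) :
    (((X + 1).num.natAbs : ℕ) : ℝ) <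
      K * ((radical (X.num.natAbs * X.den * (X + 1).num.natAbs) : ℕ) : ℝ) ^ (1 + η) := by
  -- notation
  have hN : (X + 1).num = X.num + X.den := soloInformed_num_add_one X
  set m : ℤ := X.num with hm_def
  set n : ℕ := X.den with hn_def
  set k : ℕ := m.natAbs with hk_def
  set N : ℕ := (X + 1).num.natAbs with hN_def
  have hm0 : m ≠ 0 := Rat.num_ne_zero.mpr hX0
  have hn0 : 0 < n := X.pos
  have hk0 : 0 < k := Int.natAbs_pos.mpr hm0
  have hmn0 : m + n ≠ 0 := by
    intro h
    apply hX1
    rw [← Rat.num_eq_zero, hN]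
    exact h
  have hcop : Nat.Coprime k n := X.reduced
  have hNint : (N : ℤ) = |m + (n : ℤ)| := by
    rw [hN_def, hN, Int.natCast_natAbs]
  have hkint : (k : ℤ) = |m| := by rw [hk_def, Int.natCast_natAbs]
  -- three sign cases
  rcases lt_trichotomy 0 m with hmpos | hmz | hmneg
  · -- m > 0 : triple (k, n, k + n), N = k + n
    have hkm : (k : ℤ) = m := by rw [hkint, abs_of_pos hmpos]
    have hNeq : N = k + n := by
      have : (N : ℤ) = k + n := by
        rw [hNint, hkm, abs_of_pos (by positivity)]
      exact_mod_cast this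
    have htrip : IsABCTriple k n (k + n) := ⟨hk0, hn0, rfl, hcop⟩
    have h := hK k n (k + n) htrip
    have hrad : rad k n (k + n) = radical (k * n * N) := by
      show radical (k * n * (k + n)) = _
      rw [hNeq]
    rw [hrad] at h
    have hNle : (N : ℝ) ≤ ((k + n : ℕ) : ℝ) := by rw [hNeq]
    exact lt_of_le_of_lt hNle h
  · exact absurd hmz.symm hm0
  · -- m < 0
    have hkm : (k : ℤ) = -m := by rw [hkint, abs_of_neg hmneg]
    rcases lt_trichotomy n k with hnk | hnk | hnk
    · -- k > n : m + n < 0, N = k - n, triple (n, k - n, k)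
      have hNeq : N = k - n := by
        have : (N : ℤ) = k - n := by
          rw [hNint, abs_of_neg (by omega)]
          omega
        omega
      have hcop' : Nat.Coprime n (k - n) :=
        (Nat.coprime_sub_self_right hnk.le).mpr hcop.symm
      have htrip : IsABCTriple n (k - n) k := ⟨hn0, by omega, by omega, hcop'⟩
      have h := hK n (k - n) k htrip
      have hrad : rad n (k - n) k = radical (k * n * N) := by
        show radical (n * (k - n) * k) = _
        rw [hNeq]; congr 1; ring
      rw [hrad] at h
      have hNk : (N : ℝ) ≤ k := by exact_mod_cast (show N ≤ k by omega)
      exact lt_of_le_of_lt hNk h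
    · -- k = n : then m + n = 0, excluded
      exfalso; apply hmn0; omega
    · -- k < n : m + n > 0, N = n - k, triple (k, n - k, n)
      have hNeq : N = n - k := by
        have : (N : ℤ) = n - k := by
          rw [hNint, abs_of_pos (by omega)]
          omega
        omega
      have hcop' : Nat.Coprime k (n - k) :=
        (Nat.coprime_sub_self_right hnk.le).mpr hcop
      have htrip : IsABCTriple k (n - k) n := ⟨hk0, by omega, by omega, hcop'⟩
      have h := hK k (n - k) n htrip
      have hrad : rad k (n - k) n = radical (k * n * N) := by
        show radical (k * (n - k) * n) = _
        rw [hNeq]; congr 1; ring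
      rw [hrad] at h
      have hNn : (N : ℝ) ≤ n := by exact_mod_cast (show N ≤ n by omega)
      exact lt_of_le_of_lt hNn h

/-! ### abc ⟹ Philippon's shape for every `B` (Remarque (3)), and abc ⟹ PL -/

/-- **abc ⟹ the abc-shape for the binomial `x y^B + 1`, uniformly in `B`.** If the abc conjecture holds
then for every `η > 0` there is `K > 0` such that for all `B ∈ ℕ` and all `x, y ∈ ℚ^×` with
`x y^B ≠ −1`:
`log |num (x y^B + 1)| < log K + (1 + η) · (2 h(x) + 2 h(y) + log rad num (x y^B + 1))`.
The coefficient of `h(y)` does not depend on `B` (Liouville: `B`; Philippon's PL: `ε B`, `ε < 1/2`).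
[cite: Philippon2000Addendum, Remarque (3), p. 168] -/
theorem soloInformed_philipponShape_of_abc (hABC : ABC) {η : ℝ} (hη : 0 < η) :
    ∃ K : ℝ, 0 < K ∧ ∀ (B : ℕ) (x y : ℚ), x ≠ 0 → y ≠ 0 → x * y ^ B + 1 ≠ 0 →
      Real.log (((x * y ^ B + 1).num.natAbs : ℕ) : ℝ) <
        Real.log K + (1 + η) * (2 * logHeight₁ x + 2 * logHeight₁ y +
          Real.log ((radical (x * y ^ B + 1).num.natAbs : ℕ) : ℝ)) := by
  obtain ⟨K, hK0, hK⟩ := hABC η hη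
  refine ⟨K, hK0, fun B x y hx hy hne => ?_⟩
  set X : ℚ := x * y ^ B with hX_def
  have hX0 : X ≠ 0 := mul_ne_zero hx (pow_ne_zero _ hy)
  have hmain := soloInformed_abcShape_num_add_one hK hX0 hne
  -- names and positivity
  set N : ℕ := (X + 1).num.natAbs with hN_def
  set k : ℕ := X.num.natAbs with hk_def
  set n : ℕ := X.den with hn_def
  have hN0 : 0 < N := Int.natAbs_pos.mpr (Rat.num_ne_zero.mpr hne)
  have hk0 : 0 < k := Int.natAbs_pos.mpr (Rat.num_ne_zero.mpr hX0)
  have hn0 : 0 < n := X.pos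
  have hxn : 0 < x.num.natAbs := Int.natAbs_pos.mpr (Rat.num_ne_zero.mpr hx)
  have hyn : 0 < y.num.natAbs := Int.natAbs_pos.mpr (Rat.num_ne_zero.mpr hy)
  have hxd : 0 < x.den := x.pos
  have hyd : 0 < y.den := y.pos
  -- radical bookkeeping: rad(k n N) ≤ rad k · rad n · rad N ≤ (|num x||num y|)(den x den y) rad N
  obtain ⟨hradk, hradn⟩ := soloInformed_radical_num_den_mul_pow_le hx hy B
  have hsplit : radical (k * n * N) ≤ radical k * radical n * radical N := by
    have h1 : radical (k * n * N) ∣ radical k * radical n * radical N :=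
      calc radical (k * n * N) ∣ radical (k * n) * radical N := radical_mul_dvd
        _ ∣ radical k * radical n * radical N := mul_dvd_mul_right radical_mul_dvd _
    exact Nat.le_of_dvd (by positivity) h1
  have hprod : radical (k * n * N) ≤ x.num.natAbs * y.num.natAbs * (x.den * y.den) * radical N :=
    hsplit.trans (Nat.mul_le_mul_right _ (Nat.mul_le_mul hradk hradn))
  -- pass to logarithms
  have hR0 : (0 : ℝ) < (radical (k * n * N) : ℕ) := by exact_mod_cast Nat.radical_pos _
  have hRN0 : (0 : ℝ) < (radical N : ℕ) := by exact_mod_cast Nat.radical_pos _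
  have hxn' : (0 : ℝ) < x.num.natAbs := by exact_mod_cast hxn
  have hyn' : (0 : ℝ) < y.num.natAbs := by exact_mod_cast hyn
  have hxd' : (0 : ℝ) < x.den := by exact_mod_cast hxd
  have hyd' : (0 : ℝ) < y.den := by exact_mod_cast hyd
  have hlogR : Real.log ((radical (k * n * N) : ℕ) : ℝ) ≤
      (Real.log (x.num.natAbs : ℝ) + Real.log (y.num.natAbs : ℝ)) +
        (Real.log (x.den : ℝ) + Real.log (y.den : ℝ)) + Real.log ((radical N : ℕ) : ℝ) := by
    have h1 : ((radical (k * n * N) : ℕ) : ℝ) ≤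
        (x.num.natAbs : ℝ) * y.num.natAbs * ((x.den : ℝ) * y.den) * ((radical N : ℕ) : ℝ) := by
      exact_mod_cast hprod
    have h2 := Real.log_le_log hR0 h1
    rw [Real.log_mul (by positivity) hRN0.ne', Real.log_mul (by positivity) (by positivity),
      Real.log_mul hxn'.ne' hyn'.ne', Real.log_mul hxd'.ne' hyd'.ne'] at h2
    exact h2
  obtain ⟨hx1, hx2⟩ := soloInformed_log_num_den_le_logHeight₁ hx
  obtain ⟨hy1, hy2⟩ := soloInformed_log_num_den_le_logHeight₁ hy
  -- the abc inequality in logarithms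
  have hN0' : (0 : ℝ) < (N : ℝ) := by exact_mod_cast hN0
  have hlogN : Real.log (N : ℝ) < Real.log K + (1 + η) * Real.log ((radical (k * n * N) : ℕ) : ℝ) := by
    have h1 : Real.log (N : ℝ) < Real.log (K * ((radical (k * n * N) : ℕ) : ℝ) ^ (1 + η)) :=
      Real.log_lt_log hN0' hmain
    rw [Real.log_mul hK0.ne' (Real.rpow_pos_of_pos hR0 _).ne', Real.log_rpow hR0] at h1
    exact h1
  have hsum : Real.log ((radical (k * n * N) : ℕ) : ℝ) ≤
      2 * logHeight₁ x + 2 * logHeight₁ y + Real.log ((radical N : ℕ) : ℝ) := by linarith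
  have hη1 : 0 ≤ 1 + η := by linarith
  have := mul_le_mul_of_nonneg_left hsum hη1
  linarith

/-- **abc ⟹ PL for every `B ≥ 5`**, with `ε = α = 9/(4B) < 1/2` and `β = max(log K, 0)·(4B)/(9(B+1))`
(any `β` with `(αB + ε) β ≥ log K` would do), in exactly the hypothesis shape `hPL` of
`SoloInformedPhilipponDoor.lean`. [cite: Philippon2000Addendum, Conjecture and Remarque (3), p. 167–168] -/
theorem soloInformed_philippon_of_abc_of_le (hABC : ABC) {B : ℕ} (hB : 5 ≤ B) :
    ∃ ε α β : ℝ, 0 ≤ ε ∧ ε < 1 / 2 ∧ 0 ≤ α ∧ 0 ≤ β ∧ 0 < B ∧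
      ∀ x y : ℚ, x ≠ 0 → y ≠ 0 → x * y ^ B + 1 ≠ 0 →
        Real.log (((x * y ^ B + 1).num.natAbs : ℕ) : ℝ) ≤
          (B : ℝ) * (α * logHeight₁ x + ε * logHeight₁ y) +
            (α * B + ε) * (Real.log ((radical (x * y ^ B + 1).num.natAbs : ℕ) : ℝ) + β) := by
  obtain ⟨K, hK0, hK⟩ := soloInformed_philipponShape_of_abc hABC (show (0 : ℝ) < 1 / 8 by norm_num)
  have hB0 : (0 : ℝ) < B := by exact_mod_cast (show 0 < B by omega)
  have hB5 : (5 : ℝ) ≤ B := by exact_mod_cast hB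
  set ε : ℝ := 9 / (4 * B) with hε_def
  have hε0 : 0 < ε := by positivity
  have hεB : ε * B = 9 / 4 := by rw [hε_def]; field_simp
  have hε2 : ε < 1 / 2 := by
    rw [hε_def, div_lt_iff₀ (by positivity)]; nlinarith
  set L : ℝ := max (Real.log K) 0 with hL_def
  have hL0 : 0 ≤ L := le_max_right _ _
  have hLK : Real.log K ≤ L := le_max_left _ _
  have hcoef : 0 < ε * B + ε := by positivity
  set β : ℝ := L / (ε * B + ε) with hβ_def
  have hβ0 : 0 ≤ β := div_nonneg hL0 hcoef.le
  have hβL : (ε * B + ε) * β = L := by rw [hβ_def]; field_simp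
  refine ⟨ε, ε, β, hε0.le, hε2, hε0.le, hβ0, by omega, fun x y hx hy hne => ?_⟩
  have h := hK B x y hx hy hne
  have hx0 : 0 ≤ logHeight₁ x := zero_le_logHeight₁ x
  have hy0 : 0 ≤ logHeight₁ y := zero_le_logHeight₁ y
  have hr0 : 0 ≤ Real.log ((radical (x * y ^ B + 1).num.natAbs : ℕ) : ℝ) :=
    Real.log_nonneg (by exact_mod_cast Nat.radical_pos _)
  -- (B ε) h(x) = (9/4) h(x) = (1 + 1/8)·2·h(x), likewise for y; (εB + ε) ≥ 9/8 on the radical; β covers log K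
  have e1 : (B : ℝ) * (ε * logHeight₁ x + ε * logHeight₁ y) =
      (9 / 4) * logHeight₁ x + (9 / 4) * logHeight₁ y := by
    have : (B : ℝ) * ε = 9 / 4 := by rw [mul_comm]; exact hεB
    rw [mul_add, ← mul_assoc, ← mul_assoc, this]
  have e2 : (ε * B + ε) * (Real.log ((radical (x * y ^ B + 1).num.natAbs : ℕ) : ℝ) + β) =
      (9 / 4 + ε) * Real.log ((radical (x * y ^ B + 1).num.natAbs : ℕ) : ℝ) + L := by
    rw [mul_add, hβL, hεB]
  rw [e1, e2]
  nlinarith [mul_nonneg hε0.le hr0]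

/-- **abc ⟹ PL (Philippon's conjecture is necessary for abc).** If the abc conjecture holds then there
are `0 ≤ ε < 1/2`, `α, β ≥ 0`, `B ≥ 1` (namely `B = 5`, `ε = α = 9/20`) such that for all
`x, y ∈ ℚ^×` with `x y^B ≠ −1`,
`log |num (x y^B + 1)| ≤ B (α h(x) + ε h(y)) + (αB + ε)(log rad num (x y^B + 1) + β)` —
the hypothesis `hPL` of `soloInformed_log_le_of_philippon` / `soloInformed_polynomialABC_of_philippon`
(`SoloInformedPhilipponDoor.lean`).  With that file: `ABC ⟹ PL ⟹ (W)`, i.e. PL is a rung of the ladder,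
sandwiched between the summit and polynomial abc. [cite: Philippon2000Addendum, Conjecture, Conséquence
and Remarque (3), p. 167–168] -/
theorem soloInformed_philippon_of_abc (hABC : ABC) :
    ∃ (ε α β : ℝ) (B : ℕ), 0 ≤ ε ∧ ε < 1 / 2 ∧ 0 ≤ α ∧ 0 ≤ β ∧ 0 < B ∧
      ∀ x y : ℚ, x ≠ 0 → y ≠ 0 → x * y ^ B + 1 ≠ 0 →
        Real.log (((x * y ^ B + 1).num.natAbs : ℕ) : ℝ) ≤
          (B : ℝ) * (α * logHeight₁ x + ε * logHeight₁ y) +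
            (α * B + ε) * (Real.log ((radical (x * y ^ B + 1).num.natAbs : ℕ) : ℝ) + β) := by
  obtain ⟨ε, α, β, h1, h2, h3, h4, h5, h6⟩ := soloInformed_philippon_of_abc_of_le hABC (le_refl 5)
  exact ⟨ε, α, β, 5, h1, h2, h3, h4, h5, h6⟩

/-- **PL is a rung: `ABC ⟹ PL ⟹ (W)`.** Philippon's conjecture (the existential statement over its
parameters `0 ≤ ε < 1/2`, `α, β ≥ 0`, `B ≥ 1`) is implied by the abc conjecture and implies polynomial
abc `∃ M K, c ≤ K · rad(abc)^M`.  First conjunct: this file; second: `soloInformed_polynomialABC_of_philippon`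
(`SoloInformedPhilipponDoor.lean`, Philippon's Conséquence). [cite: Philippon2000Addendum, Conjecture,
Conséquence and Remarque (3), p. 167–168] -/
theorem soloInformed_PL_rung :
    (ABC →
      ∃ (ε α β : ℝ) (B : ℕ), 0 ≤ ε ∧ ε < 1 / 2 ∧ 0 ≤ α ∧ 0 ≤ β ∧ 0 < B ∧
        ∀ x y : ℚ, x ≠ 0 → y ≠ 0 → x * y ^ B + 1 ≠ 0 →
          Real.log (((x * y ^ B + 1).num.natAbs : ℕ) : ℝ) ≤
            (B : ℝ) * (α * logHeight₁ x + ε * logHeight₁ y) +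
              (α * B + ε) * (Real.log ((radical (x * y ^ B + 1).num.natAbs : ℕ) : ℝ) + β)) ∧
    ((∃ (ε α β : ℝ) (B : ℕ), 0 ≤ ε ∧ ε < 1 / 2 ∧ 0 ≤ α ∧ 0 ≤ β ∧ 0 < B ∧
        ∀ x y : ℚ, x ≠ 0 → y ≠ 0 → x * y ^ B + 1 ≠ 0 →
          Real.log (((x * y ^ B + 1).num.natAbs : ℕ) : ℝ) ≤
            (B : ℝ) * (α * logHeight₁ x + ε * logHeight₁ y) +
              (α * B + ε) * (Real.log ((radical (x * y ^ B + 1).num.natAbs : ℕ) : ℝ) + β)) →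
      ∃ M : ℕ, ∃ K : ℝ, 0 < K ∧
        ∀ a b c : ℕ, IsABCTriple a b c → (c : ℝ) ≤ K * ((rad a b c : ℕ) : ℝ) ^ M) := by
  refine ⟨soloInformed_philippon_of_abc, ?_⟩
  rintro ⟨ε, α, β, B, hε, hε2, hα, hβ, hB, hPL⟩
  exact soloInformed_polynomialABC_of_philippon hε hε2 hα hβ hB hPL

end Summit.ABC.ABC.Theorems
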